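import Summits.AtomisticToContinuum.Crystallization.Theorems.ChartedZeroExcessLayeredLatticeLiouvilleZM

/-!
# Part ZMA «Lattice toolkit, continued» (lens-2 g79, NODE 79 — part 1b)

Generic lemmas for the PARALLEL case of (L2-C) `CoolShadowLinearChartP` (parts ZN–ZP), II:

* ZM-5 the six unit triangles at a lattice point are letter triangles (`unit_triangle_aux`, `decide`), `-triVert τ i = triVert (!τ) i`.
* ZM-6 walks: a separated sequence leaves every ball (`exists_far_of_sep`), discrete intermediate values (`discrete_ivt`), sequences on `ℤ` with
  prescribed increments (`exists_seq_of_increments`).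
* ZM-7 THE PAIR GAP OF A COOL SHADOW CRYSTAL (`placedCrystal_gap`): two sites at distance `≤ 28/25` are at distance `≤ 17/16 + 2ϑr` — the clean
  model's gap `(17/16, 6/5]` (`clean_pair_gap`, from Literature `not_isTwoShellGoodSet_of_gap` as in tree `door_pair_gap`) transported through
  `EnvClose ϑr Rs` (`Rs ≥ 28/25`) and the placing isometry.

0 sorry; standard axioms.
-/

noncomputable section
open scoped BigOperators Classical InnerProductSpace RealInnerProductSpace
open MeasureTheory Set Metric Filter Topology
open Summit.AtomisticToContinuum.Crystallization.Theorems.ChartedPlanarOrderRigidityDoor (E3 IsClean IsCharted)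
open Summit.AtomisticToContinuum.Crystallization.Theorems.ChartedPlanarOrderDensityDichotomy (μS IsSep)
open Summit.AtomisticToContinuum.Crystallization.Theorems.ChartedPlanarOrderCleanScaleP (IsCleanP IsDoorSetP isCleanP_one_iff isCleanP_μS_iff)
open Summit.AtomisticToContinuum.Crystallization.Theorems.ChartedPlanarOrderMesoCut (LayeredHom EnvClose)
open Summit.AtomisticToContinuum.Crystallization.Theorems.ChartedPlanarOrderDoorLayeredOsc (IsTwoShellAffineGood mem_iff_μS_singleton_ne_zero)
open Literature.MathematicalPhysics.StatisticalMechanics (lennardJones triangularVec₁ triangularVec₂)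
open Literature.Geometry.DiscreteGeometry (IsTwoShellGoodSet)

namespace Summit.AtomisticToContinuum.Crystallization.Theorems.ChartedZeroExcessLayeredLatticeLiouville

/-! ### ZM-5  Unit triangles are letter triangles -/

/-- ★ the six unit triangles `{0, loDir k₁, loDir k₂}` (`k₁, k₂` cyclically adjacent) at a lattice point are LETTER TRIANGLES `q₀ + triVert τ (Fin 3)`
with `q₀` one of the three vertices. [formal bookkeeping, `decide`] -/
theorem unit_triangle_aux : ∀ k₁ k₂ : Fin 6, CycAdj k₁ k₂ →
    ∃ i₀ : Fin 3, ∃ τ : Bool,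
      (∀ i : Fin 3, ∃ j : Fin 3, ![(0 : ℤ × ℤ), loDir k₁, loDir k₂] i = ![(0 : ℤ × ℤ), loDir k₁, loDir k₂] i₀ + triVert τ j) ∧
      (∀ j : Fin 3, ∃ i : Fin 3, ![(0 : ℤ × ℤ), loDir k₁, loDir k₂] i = ![(0 : ℤ × ℤ), loDir k₁, loDir k₂] i₀ + triVert τ j) := by
  decide

/-- the opposite letter triangle is the negative. [formal bookkeeping, `decide`] -/
theorem neg_triVert (τ : Bool) (i : Fin 3) : -triVert τ i = triVert (!τ) i := by
  revert τ i; decide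

/-! ### ZM-6  Walks and sequences -/

/-- a sequence of points pairwise `≥ σ₀ > 0` apart leaves every ball (a separated set meets a ball in a finite set — Literature
`finite_inter_of_separated`). [this file] -/
theorem exists_far_of_sep {g : ℕ → E3} {σ₀ : ℝ} (hσ : 0 < σ₀) (hsep : ∀ m n, m ≠ n → σ₀ ≤ dist (g m) (g n)) (x₀ : E3) (R : ℝ) :
    ∃ n, R < dist (g n) x₀ := by
  by_contra h
  push Not at h
  have hinj : Function.Injective g := by
    intro m n hmn
    by_contra hne
    have := hsep m n hne
    rw [hmn, dist_self] at this
    linarith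
  have hT : ∀ a ∈ Set.range g, ∀ b ∈ Set.range g, a ≠ b → σ₀ ≤ dist a b := by
    rintro a ⟨m, rfl⟩ b ⟨n, rfl⟩ hab
    exact hsep m n fun h => hab (by rw [h])
  have hfin : (closedBall x₀ R ∩ Set.range g).Finite :=
    Literature.Probability.Process.LocalConfig.finite_inter_of_separated hσ hT (isCompact_closedBall x₀ R)
  have hsub : Set.range g ⊆ closedBall x₀ R ∩ Set.range g := fun a ha => ⟨by obtain ⟨n, rfl⟩ := ha; exact mem_closedBall.2 (h n), ha⟩
  exact (Set.infinite_range_of_injective hinj) (hfin.subset hsub)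

/-- discrete intermediate values: a real sequence starting below `A`, reaching `A`, with increments `≤ s`, takes a value in `[A, A + s)`. [this file] -/
theorem discrete_ivt {f : ℕ → ℝ} {A s : ℝ} (h0 : f 0 < A) (hex : ∃ n, A ≤ f n) (hstep : ∀ n, f (n + 1) ≤ f n + s) :
    ∃ n, A ≤ f n ∧ f n < A + s := by
  have hn : A ≤ f (Nat.find hex) := Nat.find_spec hex
  obtain ⟨m, hm⟩ : ∃ m, Nat.find hex = m + 1 :=
    Nat.exists_eq_succ_of_ne_zero (fun h => by rw [h] at hn; linarith)
  have hlt : f m < A := not_le.1 (Nat.find_min hex (show m < Nat.find hex by omega))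
  rw [hm] at hn
  exact ⟨m + 1, hn, by linarith [hstep m]⟩

/-- a sequence on `ℤ` with prescribed increments and prescribed value at `0`. [this file] -/
theorem exists_seq_of_increments (a : E3) (Δ : ℤ → E3) : ∃ o : ℤ → E3, o 0 = a ∧ ∀ k, o (k + 1) = o k + Δ k := by
  let F : ℕ → E3 := fun n => Nat.rec a (fun m acc => acc + Δ m) n
  let G : ℕ → E3 := fun n => Nat.rec a (fun m acc => acc - Δ (-(m : ℤ) - 1)) n
  have hF : ∀ n, F (n + 1) = F n + Δ n := fun n => rfl
  have hG : ∀ n, G (n + 1) = G n - Δ (-(n : ℤ) - 1) := fun n => rfl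
  refine ⟨fun k => if 0 ≤ k then F k.toNat else G (-k).toNat, by simp [F], fun k => ?_⟩
  rcases le_or_gt 0 k with hk | hk
  · obtain ⟨n, rfl⟩ := Int.eq_ofNat_of_zero_le hk
    have h1 : (0 : ℤ) ≤ (n : ℤ) + 1 := by positivity
    have h2 : ((n : ℤ) + 1).toNat = n + 1 := by
      have : (n : ℤ) + 1 = ((n + 1 : ℕ) : ℤ) := by push_cast; ring
      rw [this, Int.toNat_natCast]
    simp only [h1, hk, if_true, h2, Int.toNat_natCast, hF]
  · obtain ⟨n, hn⟩ := Int.exists_eq_neg_ofNat hk.le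
    rcases n with _ | m
    · simp at hn; omega
    · have hk' : ¬ (0 : ℤ) ≤ k := not_le.2 hk
      rcases m with _ | m'
      · -- k = -1
        have hk1 : k = -1 := by rw [hn]; simp
        subst hk1
        simp [F, G]
      · have hk2 : ¬ (0 : ℤ) ≤ k + 1 := by rw [hn]; push_cast; omega
        have e1 : (-k).toNat = m' + 1 + 1 := by rw [hn, neg_neg]; exact Int.toNat_natCast _
        have e2 : (-(k + 1)).toNat = m' + 1 := by
          rw [hn]
          have : -(-((m' + 1 + 1 : ℕ) : ℤ) + 1) = ((m' + 1 : ℕ) : ℤ) := by push_cast; ring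
          rw [this]; exact Int.toNat_natCast _
        simp only [hk', hk2, if_false, e1, e2, hG]
        have : -((m' + 1 : ℕ) : ℤ) - 1 = k := by rw [hn]; push_cast; ring
        rw [this]
        abel

/-! ### ZM-7  The pair gap of a cool shadow crystal -/

/-- the pair gap of a CLEAN set (`IsClean (μS H)`): `dist ∉ (17/16, 6/5]` — tree `door_pair_gap` at `aHi = 1` without the door's other binders. [this file] -/
theorem clean_pair_gap {H : Set E3} (hcl : IsClean (μS H)) {p q : E3} (hp : p ∈ H) (hq : q ∈ H) (h₁ : 17 / 16 < dist p q) : 6 / 5 < dist p q := by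
  by_contra hcon
  rw [not_lt] at hcon
  have hgood : IsTwoShellGoodSet (1 / 16) (9 / 10) 1 H q := (isCleanP_μS_iff H).1 ((isCleanP_one_iff _).2 hcl) q hq
  have hpq : p ≠ q := by
    rintro rfl
    rw [dist_self] at h₁
    linarith
  have hs := sqrt_two_window.1
  exact not_isTwoShellGoodSet_of_gap (ε := 1 / 16) (aLo := 9 / 10) (aHi := 1) (by norm_num) (by norm_num) hp hpq (by linarith)
    (by nlinarith) hgood

/-- ★ **THE PAIR GAP OF A COOL SHADOW CRYSTAL (PROVED).**  Two sites of the placed crystal at distance `≤ 28/25` are at distance `≤ 17/16 + 2ϑr`: the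
crystal is `(ϑr, Rs)`-environment-close to the CLEAN configuration `H` (`IsCoolShadowCrystal`, clause 3), whose pairs avoid `(17/16, 6/5]`. [this file] -/
theorem placedCrystal_gap {σ ϑr Rs ε r rI ℓ : ℝ} {S K H : Set E3} {L' : E3 →L[ℝ] E3} {w' : ℤ → E3} {U : E3 ≃ₗᵢ[ℝ] E3} {t : E3}
    (hcl : IsClean (μS H)) (hcr : IsCoolShadowCrystal σ ϑr Rs ε r rI ℓ S K H L' w' U t) (hRs : 28 / 25 ≤ Rs) (hϑ₀ : 0 ≤ ϑr)
    {c c' : E3} (hc : c ∈ placedCrystal L' w' U t) (hc' : c' ∈ placedCrystal L' w' U t) (h : dist c c' ≤ 28 / 25) :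
    dist c c' ≤ 17 / 16 + 2 * ϑr := by
  by_contra hcon
  rw [not_le] at hcon
  have hx' : U (c - t) ∈ LayeredHom L' w' := hc
  have hy' : U (c' - t) ∈ LayeredHom L' w' := hc'
  have hd : dist (U (c' - t)) (U (c - t)) = dist c c' := by rw [U.dist_map, dist_sub_right, dist_comm]
  obtain ⟨x, hx, hE⟩ := hcr.2.2.1 _ hx'
  obtain ⟨q, hq, hq'⟩ := hE.1 _ hy' (by rw [hd]; linarith)
  obtain ⟨q₀, hq₀, hq₀'⟩ := hE.1 _ hx' (by rw [dist_self]; linarith)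
  rw [sub_self, dist_eq_norm, zero_sub, norm_neg] at hq₀'
  have key : dist (U (c' - t) - U (c - t)) (q - q₀) ≤ 2 * ϑr := by
    calc dist (U (c' - t) - U (c - t)) (q - q₀) ≤ dist (U (c' - t) - U (c - t)) (q - x) + dist (q - x) (q - q₀) := dist_triangle _ _ _
      _ ≤ ϑr + ϑr := by
          gcongr
          rw [dist_eq_norm, sub_sub_sub_cancel_left]; exact hq₀'
      _ = 2 * ϑr := by ring
  have hn : ‖U (c' - t) - U (c - t)‖ = dist c c' := by rw [← dist_eq_norm, hd]
  have hqq : |dist c c' - dist q q₀| ≤ 2 * ϑr := by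
    rw [← hn, dist_eq_norm q q₀]
    exact (abs_norm_sub_norm_le _ _).trans (by rwa [← dist_eq_norm])
  have hqq' := abs_le.1 hqq
  have hgap := clean_pair_gap hcl hq hq₀ (by linarith)
  linarith

end Summit.AtomisticToContinuum.Crystallization.Theorems.ChartedZeroExcessLayeredLatticeLiouville
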